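import Summits.NavierStokesRegularity.FluidComputer.DampedTransitionBeable
import Summits.NavierStokesRegularity.FluidComputer.HeadStartDouse

/-!
# Tao's delay gate from a SIGNED CLOCK HEAD-START, part 7: (toke), (beable) and the head-start gate theorem

Companion of `HeadStart{Transition,Quiet,Sub,Window,Fire,Douse}.lean` (cell `pub-fluidc`, blueprint seat bp1;
ONE text split by the 400-line rule; namespace `Summit.NavierStokesRegularity.FluidComputer.HeadStart`). HONEST
FRAMING (verbatim): low prior, high value-of-information experiment on Tao's machine paradigm; NOT a claim that
NS blows up. Five-mode truncation (5.5) of [Tao2016AveragedNS, §5.5] in the retuned form `delayCircuitWith K M ε`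
with a diagonal damping `-E(t) * X(t)`, `0 ≤ Eᵢ(t) ≤ η`, on `[0,2]`, started in the signed head-start class
`HS±(ε)` of part 1 (hypothesis `h0`, `h = b₀/ε ∈ [-1/5, 2/5]`, `h₋ = max(-h,0)`); nothing is proved about NS.
* `KVe_small`, `Es_decay` ((toke)), `late_sum_sq`, `beable_of_sum_sq` ((beable), damped) —
  `DampedTransitionBeable.lean` carried VERBATIM to the class;
* `window_fits`, `abs_add_sub_sqrt_le` — the second window `[t_c + 888 log K/M + 1/√K, 2]` still fits in
  `[0,2]` (`t_c ≤ 33/20` even for a clock behind by `ε/5`), and the window of part 4 in the form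
  `|t_c + h - √(2 + h²)| ≤ 24 log K/M + 30η + h₋²`;
* `firingPhase` — **THE SIGNED HEAD-START GATE THEOREM**: Thm 5.3 for the family `3000 log K ≤ M ≤ K¹⁰`,
  `K ≥ 2·20⁴²·42! + 16`, `0 < ε ≤ e^{-10M}/K¹⁰⁰`, under ANY pointwise-bounded diagonal damping
  `0 ≤ Eᵢ(t) ≤ η ≤ 1/1000` on `[0,2]`, from ANY datum of `HS±(ε)`: a critical time `t_c` with
  `|t_c - (√(2 + h²) - h)| ≤ 24 log K/M + 30η + h₋²`, (able) on `[0, t_c]`, (beable) on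
  `[t_c + 888 log K/M + 1/√K, 2]`, levels `200K⁻¹⁰ + O(η)` — the SAME boxes as `DampedTransition.firingPhase`
  (`h = 0`). Reading: a clock off by `b₀ = hε`, `h ∈ [-1/5, 2/5]`, at hand-off does not spoil the gate; AHEAD
  (`h > 0`) it fires EARLIER, at `√(2 + h²) - h` (sharp), BEHIND LATER, at `√2 + |h|` up to the `O(h²)` slack.
[cite: Tao2016AveragedNS, §5.5 Thm 5.3 proof: (toke), (beable), (able), (tcable)]. No named facts; 0 sorry.
-/

noncomputable section

namespace Summit.NavierStokesRegularity.FluidComputer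

open Real Set Filter Topology
open Literature.Analysis.FluidPDE.Tao2016AveragedNS
open Literature.Analysis.FluidPDE.Tao2016AveragedNS.Thm53 (antitoneOn_intFactor invSqrt_facts decay_alg)
open Literature.Analysis.FluidPDE.Tao2016AveragedNS.Thm53With (family_params eps_facts)
open DampedTransition (hasDerivAt_a hasDerivAt_b hasDerivAt_c hasDerivAt_d hasDerivAt_e hasDerivAt_Es family_params_damped)

namespace HeadStart

section Decay

variable {K M ε η τ δ : ℝ} {E X : ℝ → Fin 5 → ℝ}

/-- On `I = [t_c + δ, 2]`: `|½K·V·ã| ≤ ½K⁻⁹⁹` (`V = adε²/c`, `ε²/c ≤ K⁻¹⁰⁰`).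
[cite: Tao2016AveragedNS, §5.5 (proof of (beable))] -/
theorem KVe_small
    (hX : ∀ t ∈ Icc (0:ℝ) 2, HasDerivAt X (delayCircuitWith K M ε (X t) - E t * X t) t)
    (hE : ∀ t ∈ Icc (0:ℝ) 2, ∀ i, 0 ≤ E t i ∧ E t i ≤ η)
    (h0 : X 0 0 ^ 2 + X 0 1 ^ 2 = 1 ∧ 0 ≤ X 0 0 ∧ -(1 / 5 * ε) ≤ X 0 1 ∧ X 0 1 ≤ 2 / 5 * ε ∧ X 0 2 = 0 ∧ X 0 3 = 0 ∧ X 0 4 = 0)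
    (hε : 0 < ε) (hε1 : ε ≤ 1) (hM0 : 0 < M) (hMK : M ≤ K ^ 10) (hK : 16 ≤ K) (hεK : ε ^ 2 ≤ 1 / (12 * K ^ 20))
    (hεexp : ε ^ 2 ≤ exp (-(18 * M)) / (64 * M)) (hη : η ≤ 1 / 100)
    (hδ : 0 ≤ δ) (hon : K ^ 111 ≤ exp (M * δ / 8))
    (hτ1 : 1 ≤ τ) (hτ2 : τ ≤ 2)
    (hcτ : ∀ t, 0 ≤ t → t ≤ τ → X t 2 ≤ ε ^ 2 / K ^ 10) (hcτeq : X τ 2 = ε ^ 2 / K ^ 10)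
    {s : ℝ} (hs : s ∈ Icc (τ + δ) 2) :
    |K / 2 * (X s 0 * X s 3 * (ε ^ 2 * (X s 2)⁻¹) * X s 4)| ≤ 1 / 2 / K ^ 99 := by
  have hK0 : 0 < K := by linarith
  have hs02 : s ∈ Icc (0 : ℝ) 2 := ⟨by linarith [hs.1], hs.2⟩
  have hcl : K ^ 100 * ε ^ 2 ≤ X s 2 :=
    c_large hX hE h0 hε hε1 hM0 hMK hK hεK hεexp hη hδ hon hτ1 hτ2 hcτ hcτeq hs
  have hcpos : 0 < X s 2 := lt_of_lt_of_le (by positivity) hcl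
  have hq0 : 0 ≤ ε ^ 2 * (X s 2)⁻¹ := by positivity
  have hq : ε ^ 2 * (X s 2)⁻¹ ≤ 1 / K ^ 100 := by
    rw [← div_eq_mul_inv, div_le_div_iff₀ hcpos (by positivity), one_mul]; linarith
  rw [abs_mul, abs_of_pos (by positivity : 0 < K / 2), abs_mul, abs_mul, abs_mul,
    abs_of_nonneg hq0]
  calc K / 2 * (|X s 0| * |X s 3| * (ε ^ 2 * (X s 2)⁻¹) * |X s 4|)
      ≤ K / 2 * (1 * 1 * (1 / K ^ 100) * 1) := by
        refine mul_le_mul_of_nonneg_left ?_ (by positivity)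
        exact mul_le_mul (mul_le_mul (mul_le_mul (traj_abs_le_one hX hE h0 hs02 0)
          (traj_abs_le_one hX hE h0 hs02 3) (abs_nonneg _) zero_le_one) hq hq0 (by norm_num))
          (traj_abs_le_one hX hE h0 hs02 4) (abs_nonneg _) (by positivity)
    _ = 1 / 2 / K ^ 99 := by field_simp

/-- **(toke)**: Grönwall for `E_*` at the constant rate `K/10` from `t' = t_c + δ + 1/K`, evaluated on
`[t_c + δ + 1/√K, 2]`: `E_*(t) ≤ e^{-(K/10)(t-t')}·1 + 70K⁻⁹⁰ ≤ e^{(1-√K)/10} + 70K⁻⁹⁰`.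
[cite: Tao2016AveragedNS, §5.5 (toke), (proof of (beable))] -/
theorem Es_decay
    (hX : ∀ t ∈ Icc (0:ℝ) 2, HasDerivAt X (delayCircuitWith K M ε (X t) - E t * X t) t)
    (hE : ∀ t ∈ Icc (0:ℝ) 2, ∀ i, 0 ≤ E t i ∧ E t i ≤ η)
    (h0 : X 0 0 ^ 2 + X 0 1 ^ 2 = 1 ∧ 0 ≤ X 0 0 ∧ -(1 / 5 * ε) ≤ X 0 1 ∧ X 0 1 ≤ 2 / 5 * ε ∧ X 0 2 = 0 ∧ X 0 3 = 0 ∧ X 0 4 = 0)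
    (hε : 0 < ε) (hε1 : ε ≤ 1) (hM0 : 0 < M) (hMK : M ≤ K ^ 10) (hK : 16 ≤ K) (hεK : ε ^ 2 ≤ 1 / (12 * K ^ 20))
    (hε100 : ε ≤ 1 / K ^ 100) (hεexp : ε ^ 2 ≤ exp (-(18 * M)) / (64 * M)) (hη : η ≤ 1 / 100)
    (hδ : 0 ≤ δ) (hon : K ^ 111 ≤ exp (M * δ / 8))
    (hτ1 : 1 ≤ τ) (hfit : τ + δ + (sqrt K)⁻¹ ≤ 2)
    (hcτ : ∀ t, 0 ≤ t → t ≤ τ → X t 2 ≤ ε ^ 2 / K ^ 10) (hcτeq : X τ 2 = ε ^ 2 / K ^ 10)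
    {t : ℝ} (ht : t ∈ Icc (τ + δ + 1 / sqrt K) 2) :
    (X t 0 ^ 2 + X t 1 ^ 2 + X t 2 ^ 2 + X t 3 ^ 2) / 2
        - K / 2 * (X t 0 * X t 3 * (ε ^ 2 * (X t 2)⁻¹) * X t 4)
      ≤ exp ((1 - sqrt K) / 10) + 70 / K ^ 90 := by
  have hK0 : 0 < K := by linarith
  have hK1 : 1 ≤ K := by linarith
  obtain ⟨hs0, hs4, hKs, h4, hKs2⟩ := invSqrt_facts hK
  have hτ2 : τ ≤ 2 := by linarith
  have hu0' : 0 < K⁻¹ := inv_pos.2 hK0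
  have hκ : 0 < K / 10 := by positivity
  have hKinv : K⁻¹ ≤ (sqrt K)⁻¹ := by
    rw [inv_le_inv₀ hK0 (by positivity)]
    calc sqrt K ≤ sqrt K * sqrt K := le_mul_of_one_le_right (by positivity) (by linarith)
      _ = K := mul_self_sqrt hK0.le
  have ht't : τ + δ + K⁻¹ ≤ t := by rw [one_div] at ht; linarith [ht.1]
  have hI : ∀ s ∈ Icc (τ + δ + K⁻¹) 2, s ∈ Icc (τ + δ) 2 := fun s hs =>
    ⟨by linarith [hs.1], hs.2⟩
  have ht'02 : τ + δ + K⁻¹ ∈ Icc (0:ℝ) 2 := ⟨by linarith, by linarith⟩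
  have hC0 : 0 ≤ 7 / K ^ 89 / (K / 10) := by positivity
  have hanti := antitoneOn_intFactor (s := Icc (τ + δ + K⁻¹) 2)
    (f := fun s => (X s 0 ^ 2 + X s 1 ^ 2 + X s 2 ^ 2 + X s 3 ^ 2) / 2
      - K / 2 * (X s 0 * X s 3 * (ε ^ 2 * (X s 2)⁻¹) * X s 4))
    (g := fun _ => -(K / 10)) (G := fun s => -(K / 10 * s))
    (φ := fun s => 7 / K ^ 89 * exp (K / 10 * s))
    (Φ := fun s => 7 / K ^ 89 / (K / 10) * exp (K / 10 * s))
    (convex_Icc _ 2)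
    (fun s hs => by
      have hsI := hI s hs
      have hs02 : s ∈ Icc (0:ℝ) 2 := ⟨by linarith [hs.1], hs.2⟩
      have hcl : K ^ 100 * ε ^ 2 ≤ X s 2 :=
        c_large hX hE h0 hε hε1 hM0 hMK hK hεK hεexp hη hδ hon hτ1 hτ2 hcτ hcτeq hsI
      have hcne : X s 2 ≠ 0 := (lt_of_lt_of_le (by positivity) hcl).ne'
      exact hasDerivAt_Es (hX s hs02) hε.ne' hcne)
    (fun s _ => ((hasDerivAt_id s).const_mul (K / 10)).neg.congr_deriv (by simp))
    (fun s _ => by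
      have hne : K / 10 ≠ 0 := hκ.ne'
      have := (((hasDerivAt_id s).const_mul (K / 10)).exp).const_mul (7 / K ^ 89 / (K / 10))
      refine this.congr_deriv ?_
      simp only [mul_one, id_eq]
      field_simp)
    (fun s hs => by
      have hdis := Es_dissipation hX hE h0 hε hε1 hM0 hMK hK hεK hε100 hεexp hη hδ hon hτ1 hfit hcτ
        hcτeq hs
      have hE' : exp (-(-(K / 10 * s))) = exp (K / 10 * s) := by rw [neg_neg]
      rw [hE']
      have h2 := mul_le_mul_of_nonneg_right hdis (exp_pos (K / 10 * s)).le
      linarith)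
  have ht'mem : τ + δ + K⁻¹ ∈ Icc (τ + δ + K⁻¹) 2 := ⟨le_rfl, by linarith⟩
  have htmem : t ∈ Icc (τ + δ + K⁻¹) 2 := ⟨ht't, ht.2⟩
  have hA := hanti ht'mem htmem ht't
  simp only [neg_neg] at hA
  have hsplit : exp (K / 10 * (τ + δ + K⁻¹))
      = exp (K / 10 * t) * exp (K / 10 * ((τ + δ + K⁻¹) - t)) := by
    rw [← exp_add]; congr 1; ring
  rw [hsplit] at hA
  -- `E_*(t') ≤ 1`
  have hEs1 : (X (τ + δ + K⁻¹) 0 ^ 2 + X (τ + δ + K⁻¹) 1 ^ 2 + X (τ + δ + K⁻¹) 2 ^ 2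
        + X (τ + δ + K⁻¹) 3 ^ 2) / 2
      - K / 2 * (X (τ + δ + K⁻¹) 0 * X (τ + δ + K⁻¹) 3 * (ε ^ 2 * (X (τ + δ + K⁻¹) 2)⁻¹)
        * X (τ + δ + K⁻¹) 4) ≤ 1 := by
    obtain ⟨-, hS1⟩ := sum_sq_sandwich hX hE h0 ht'02
    have h2 := (abs_le.1 (KVe_small hX hE h0 hε hε1 hM0 hMK hK hεK hεexp hη hδ hon hτ1 hτ2 hcτ hcτeq
      (hI _ ht'mem))).1
    have h3 : 1 / 2 / K ^ 99 ≤ 1 / 2 := by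
      rw [div_le_iff₀ (by positivity)]
      have : (1 : ℝ) ≤ K ^ 99 := one_le_pow₀ hK1
      linarith
    linarith [sq_nonneg (X (τ + δ + K⁻¹) 4)]
  have hρ0 : 0 < exp (K / 10 * ((τ + δ + K⁻¹) - t)) := exp_pos _
  have hEst := decay_alg (exp_pos _) hρ0 hC0 hEs1 hA
  -- `ρ ≤ exp((1 - √K)/10)`
  have hρle : exp (K / 10 * ((τ + δ + K⁻¹) - t)) ≤ exp ((1 - sqrt K) / 10) := by
    rw [exp_le_exp]
    have h2 : K / 10 * ((τ + δ + K⁻¹) - t) ≤ K / 10 * (K⁻¹ - (sqrt K)⁻¹) := by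
      refine mul_le_mul_of_nonneg_left ?_ hκ.le
      rw [one_div] at ht; linarith [ht.1]
    have h3 : K / 10 * (K⁻¹ - (sqrt K)⁻¹) = (1 - sqrt K) / 10 := by
      have hKK : K * K⁻¹ = 1 := mul_inv_cancel₀ hK0.ne'
      calc K / 10 * (K⁻¹ - (sqrt K)⁻¹) = (K * K⁻¹ - K * (sqrt K)⁻¹) / 10 := by ring
        _ = (1 - sqrt K) / 10 := by rw [hKs, hKK]
    linarith
  have hCle : 7 / K ^ 89 / (K / 10) ≤ 70 / K ^ 90 := by
    rw [div_le_div_iff₀ hκ (by positivity)]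
    calc 7 / K ^ 89 * K ^ 90 = 7 * K := by field_simp
      _ ≤ 70 * (K / 10) := by linarith
  linarith

/-- **(toke) ⇒ (beable), core estimate**: on `[t_c + δ + 1/√K, 2]`, `a² + b² + c² + d² ≤ 142K⁻²⁰`
(`= 2E_* + KVã`; needs `2e^{(1-√K)/10} ≤ K⁻²⁰`). [cite: Tao2016AveragedNS, §5.5 (beable)] -/
theorem late_sum_sq
    (hX : ∀ t ∈ Icc (0:ℝ) 2, HasDerivAt X (delayCircuitWith K M ε (X t) - E t * X t) t)
    (hE : ∀ t ∈ Icc (0:ℝ) 2, ∀ i, 0 ≤ E t i ∧ E t i ≤ η)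
    (h0 : X 0 0 ^ 2 + X 0 1 ^ 2 = 1 ∧ 0 ≤ X 0 0 ∧ -(1 / 5 * ε) ≤ X 0 1 ∧ X 0 1 ≤ 2 / 5 * ε ∧ X 0 2 = 0 ∧ X 0 3 = 0 ∧ X 0 4 = 0)
    (hε : 0 < ε) (hε1 : ε ≤ 1) (hM0 : 0 < M) (hMK : M ≤ K ^ 10) (hK : 16 ≤ K) (hεK : ε ^ 2 ≤ 1 / (12 * K ^ 20))
    (hε100 : ε ≤ 1 / K ^ 100) (hεexp : ε ^ 2 ≤ exp (-(18 * M)) / (64 * M)) (hη : η ≤ 1 / 100)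
    (hδ : 0 ≤ δ) (hon : K ^ 111 ≤ exp (M * δ / 8)) (hN4 : 2 * exp ((1 - sqrt K) / 10) ≤ 1 / K ^ 20)
    (hτ1 : 1 ≤ τ) (hfit : τ + δ + (sqrt K)⁻¹ ≤ 2)
    (hcτ : ∀ t, 0 ≤ t → t ≤ τ → X t 2 ≤ ε ^ 2 / K ^ 10) (hcτeq : X τ 2 = ε ^ 2 / K ^ 10)
    {t : ℝ} (ht : t ∈ Icc (τ + δ + 1 / sqrt K) 2) :
    X t 0 ^ 2 + X t 1 ^ 2 + X t 2 ^ 2 + X t 3 ^ 2 ≤ 142 / K ^ 20 := by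
  have hK0 : 0 < K := by linarith
  have hK1 : 1 ≤ K := by linarith
  obtain ⟨hs0, hs4, hKs, h4, hKs2⟩ := invSqrt_facts hK
  have hτ2 : τ ≤ 2 := by linarith
  have htI : t ∈ Icc (τ + δ) 2 := ⟨by rw [one_div] at ht; linarith [ht.1], ht.2⟩
  have hEs := Es_decay hX hE h0 hε hε1 hM0 hMK hK hεK hε100 hεexp hη hδ hon hτ1 hfit hcτ hcτeq ht
  have hVt := (abs_le.1 (KVe_small hX hE h0 hε hε1 hM0 hMK hK hεK hεexp hη hδ hon hτ1 hτ2 hcτ hcτeq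
    htI)).2
  have h99 : 1 / 2 / K ^ 99 ≤ 1 / 2 / K ^ 20 := by
    apply div_le_div_of_nonneg_left (by norm_num) (by positivity)
    exact pow_le_pow_right₀ hK1 (by norm_num)
  have h90 : 70 / K ^ 90 ≤ 70 / K ^ 20 := by
    apply div_le_div_of_nonneg_left (by norm_num) (by positivity)
    exact pow_le_pow_right₀ hK1 (by norm_num)
  have hexp20 : exp ((1 - sqrt K) / 10) ≤ 1 / 2 / K ^ 20 := by
    have h := hN4
    rw [div_div, le_div_iff₀ (by positivity)]
    rw [le_div_iff₀ (by positivity)] at h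
    linarith
  have hw1 : (1 : ℝ) / 2 / K ^ 20 = 1 / 2 * (K ^ 20)⁻¹ := by ring
  have hw2 : (70 : ℝ) / K ^ 20 = 70 * (K ^ 20)⁻¹ := by ring
  have hw3 : (142 : ℝ) / K ^ 20 = 142 * (K ^ 20)⁻¹ := by ring
  rw [hw3]
  rw [hw1] at hexp20 h99
  rw [hw2] at h90
  linarith

/-- From `Σ_{i<4} Xᵢ² ≤ 142K⁻²⁰`, `ã ≥ 0` and the energy SANDWICH `1 - 2ηt ≤ Σ Xᵢ² ≤ 1`: all of
(beable), with `|ã - 1| ≤ 200K⁻¹⁰ + 4η`. [cite: Tao2016AveragedNS, §5.5 (beable)] -/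
theorem beable_of_sum_sq
    (hX : ∀ t ∈ Icc (0:ℝ) 2, HasDerivAt X (delayCircuitWith K M ε (X t) - E t * X t) t)
    (hE : ∀ t ∈ Icc (0:ℝ) 2, ∀ i, 0 ≤ E t i ∧ E t i ≤ η)
    (h0 : X 0 0 ^ 2 + X 0 1 ^ 2 = 1 ∧ 0 ≤ X 0 0 ∧ -(1 / 5 * ε) ≤ X 0 1 ∧ X 0 1 ≤ 2 / 5 * ε ∧ X 0 2 = 0 ∧ X 0 3 = 0 ∧ X 0 4 = 0)
    (hK : 16 ≤ K) {t : ℝ} (ht : t ∈ Icc (0:ℝ) 2)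
    (hS : X t 0 ^ 2 + X t 1 ^ 2 + X t 2 ^ 2 + X t 3 ^ 2 ≤ 142 / K ^ 20) :
    |X t 4 - 1| ≤ 200 / K ^ 10 + 4 * η ∧ ∀ i : Fin 5, i ≠ 4 → |X t i| ≤ 200 / K ^ 10 := by
  have hK0 : 0 < K := by linarith
  have hK1 : 1 ≤ K := by linarith
  have hη0 : 0 ≤ η := (hE 0 ⟨le_rfl, zero_le_two⟩ 0).1.trans (hE 0 ⟨le_rfl, zero_le_two⟩ 0).2
  obtain ⟨hSlo, hShi⟩ := sum_sq_sandwich hX hE h0 ht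
  have he0 : 0 ≤ X t 4 := e_nonneg hX hE h0 hK0.le ht
  have he1 : X t 4 ≤ 1 := (le_abs_self _).trans (traj_abs_le_one hX hE h0 ht 4)
  have h2010 : 142 / K ^ 20 ≤ 142 / K ^ 10 := by
    apply div_le_div_of_nonneg_left (by norm_num) (by positivity)
    exact pow_le_pow_right₀ hK1 (by norm_num)
  have h142 : 142 / K ^ 10 ≤ 200 / K ^ 10 :=
    div_le_div_of_nonneg_right (by norm_num) (by positivity)
  have hsq : ∀ x : ℝ, x ^ 2 ≤ 142 / K ^ 20 → |x| ≤ 200 / K ^ 10 := by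
    intro x hx
    have hx' : x ^ 2 ≤ (12 / K ^ 10) ^ 2 := by
      rw [div_pow, show (K ^ 10) ^ 2 = K ^ 20 by ring]
      exact hx.trans (div_le_div_of_nonneg_right (by norm_num) (by positivity))
    calc |x| ≤ sqrt ((12 / K ^ 10) ^ 2) := abs_le_sqrt hx'
      _ = 12 / K ^ 10 := sqrt_sq (by positivity)
      _ ≤ 200 / K ^ 10 := div_le_div_of_nonneg_right (by norm_num) (by positivity)
  have hx0 : X t 0 ^ 2 ≤ 142 / K ^ 20 := by
    linarith [sq_nonneg (X t 1), sq_nonneg (X t 2), sq_nonneg (X t 3)]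
  have hx1 : X t 1 ^ 2 ≤ 142 / K ^ 20 := by
    linarith [sq_nonneg (X t 0), sq_nonneg (X t 2), sq_nonneg (X t 3)]
  have hx2 : X t 2 ^ 2 ≤ 142 / K ^ 20 := by
    linarith [sq_nonneg (X t 0), sq_nonneg (X t 1), sq_nonneg (X t 3)]
  have hx3 : X t 3 ^ 2 ≤ 142 / K ^ 20 := by
    linarith [sq_nonneg (X t 0), sq_nonneg (X t 1), sq_nonneg (X t 2)]
  have ha := hsq _ hx0
  have hb := hsq _ hx1
  have hc := hsq _ hx2
  have hd := hsq _ hx3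
  refine ⟨?_, ?_⟩
  · rw [abs_sub_comm, abs_of_nonneg (by linarith)]
    have h1 : 1 - X t 4 ≤ 1 - X t 4 ^ 2 := by nlinarith
    have h2 : 2 * η * t ≤ 2 * η * 2 := mul_le_mul_of_nonneg_left ht.2 (by positivity)
    linarith
  · intro i hi
    fin_cases i
    · exact ha
    · exact hb
    · exact hc
    · exact hd
    · exact absurd rfl hi

end Decay

section Assembly

/-! ## Assembly of the head-start gate theorem for the family -/

/-- The second window fits inside `[0,2]`: `τ ≤ 33/20` (part 4), `δ ≤ 888/3000`, `1/√K ≤ 1/20`.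
[cite: Tao2016AveragedNS, §5.5 ("for `K` large enough")] -/
theorem window_fits {K τ δ : ℝ} (hK : 400 ≤ K) (hτ : τ ≤ 33 / 20) (hδ : δ ≤ 888 / 3000) :
    τ + δ + (sqrt K)⁻¹ ≤ 2 := by
  have hs : (20:ℝ) ≤ sqrt K := (Real.le_sqrt' (by norm_num)).2 (by norm_num; linarith)
  have hinv : 1 / sqrt K ≤ 1 / 20 := one_div_le_one_div_of_le (by norm_num) hs
  rw [one_div (sqrt K)] at hinv
  linarith

/-- The window `2 - x ≤ τ² + 2hτ ≤ 2 + y` (`τ ≥ 1`, `h ≥ -1/5`, `y ≤ x`) in the form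
`|τ + h - √(2 + h²)| ≤ x`, i.e. `t_c = √(2 + h²) - h + O(x)`. [cite: Tao2016AveragedNS, §5.5 (tcable)] -/
theorem abs_add_sub_sqrt_le {τ h x y : ℝ} (hτ : 1 ≤ τ) (hh : -(1 / 5) ≤ h) (hx : 0 ≤ x) (hyx : y ≤ x)
    (hlo : 2 - x ≤ τ ^ 2 + 2 * h * τ) (hhi : τ ^ 2 + 2 * h * τ ≤ 2 + y) :
    |τ + h - sqrt (2 + h ^ 2)| ≤ x := by
  have h72 := Thm53.sqrt_two_gt
  have hr2 : sqrt (2 + h ^ 2) ^ 2 = 2 + h ^ 2 := sq_sqrt (by positivity)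
  have hr : sqrt 2 ≤ sqrt (2 + h ^ 2) := sqrt_le_sqrt (by nlinarith)
  have hsum : 2 ≤ τ + h + sqrt (2 + h ^ 2) := by linarith
  rw [abs_le]
  constructor
  · have : (sqrt (2 + h ^ 2) - (τ + h)) * (τ + h + sqrt (2 + h ^ 2)) = 2 - (τ ^ 2 + 2 * h * τ) := by
      nlinarith
    nlinarith
  · have : (τ + h - sqrt (2 + h ^ 2)) * (τ + h + sqrt (2 + h ^ 2)) = τ ^ 2 + 2 * h * τ - 2 := by
      nlinarith
    nlinarith

end Assembly

end HeadStart

open HeadStart in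
/-- **THE HEAD-START GATE THEOREM (Theorem 5.3 of [Tao2016AveragedNS] for the family, under non-uniform
diagonal damping, from a mis-charged clock of either sign).** For `K ≥ 2·20⁴²·42! + 16`,
`3000 log K ≤ M ≤ K¹⁰`, `0 < ε ≤ e^{-10M}/K¹⁰⁰`, ANY diagonal damping `0 ≤ Eᵢ(t) ≤ η ≤ 1/1000` on `[0,2]` and
ANY `X` with `Ẋ = delayCircuitWith K M ε X - E(t) * X` on `[0,2]` from ANY datum with `a₀² + b₀² = 1`, `a₀ ≥ 0`,
`-ε/5 ≤ b₀ ≤ 2ε/5`, `c₀ = d₀ = ã₀ = 0` (signed head-start `h = b₀/ε`, `h₋ = max(-h,0)`): a critical time `t_c`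
with `|t_c + h - √(2 + h²)| ≤ 24 log K / M + 30η + h₋²` (sharp for `h ≥ 0`; for `h < 0` the true value is
`√2 + |h|`, inside the window); (able) on ALL of `[0, t_c]` — `|a - 1| ≤ 200K⁻¹⁰ + 2η`, `|b|,|c|,|d|,|ã| ≤ 200K⁻¹⁰`;
(beable) on `[t_c + 888 log K/M + 1/√K, 2]` — `|ã - 1| ≤ 200K⁻¹⁰ + 4η`, `|a|,|b|,|c|,|d| ≤ 200K⁻¹⁰`. For
`b₀ = 0` this is `DampedTransition.firingPhase` up to `20η ↦ 30η`. HONEST FRAMING: a theorem about a five-mode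
ODE; low prior, high value-of-information experiment on Tao's machine paradigm; NOT a claim that NS blows up.
[cite: Tao2016AveragedNS, Theorem 5.3, §5.5] -/
theorem HeadStart.firingPhase {K M ε η : ℝ} {E X : ℝ → Fin 5 → ℝ}
    (hX : ∀ t ∈ Icc (0:ℝ) 2, HasDerivAt X (delayCircuitWith K M ε (X t) - E t * X t) t)
    (hE : ∀ t ∈ Icc (0:ℝ) 2, ∀ i, 0 ≤ E t i ∧ E t i ≤ η)
    (h0 : X 0 0 ^ 2 + X 0 1 ^ 2 = 1 ∧ 0 ≤ X 0 0 ∧ -(1 / 5 * ε) ≤ X 0 1 ∧ X 0 1 ≤ 2 / 5 * ε ∧ X 0 2 = 0 ∧ X 0 3 = 0 ∧ X 0 4 = 0)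
    (hK : 2 * 20 ^ 42 * (Nat.factorial 42 : ℝ) + 16 ≤ K) (hML : 3000 * Real.log K ≤ M)
    (hMK : M ≤ K ^ 10) (hε : 0 < ε) (hεle : ε ≤ exp (-(10 * M)) / K ^ 100) (hη : η ≤ 1 / 1000) :
    ∃ tc : ℝ, |tc + X 0 1 / ε - Real.sqrt (2 + (X 0 1 / ε) ^ 2)| ≤ 24 * Real.log K / M + 30 * η + (max (-(X 0 1 / ε)) 0) ^ 2 ∧
      (∀ t ∈ Icc 0 tc,
        |X t 0 - 1| ≤ 200 / K ^ 10 + 2 * η ∧ ∀ i : Fin 5, i ≠ 0 → |X t i| ≤ 200 / K ^ 10) ∧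
      (∀ t ∈ Icc (tc + 888 * Real.log K / M + 1 / Real.sqrt K) 2,
        |X t 4 - 1| ≤ 200 / K ^ 10 + 4 * η ∧ ∀ i : Fin 5, i ≠ 4 → |X t i| ≤ 200 / K ^ 10) := by
  obtain ⟨hK16, hM0, -, hlog2, hN4, -⟩ := family_params hK hML
  have hf : (1:ℝ) ≤ (Nat.factorial 42 : ℝ) := Nat.one_le_cast.2 (Nat.factorial_pos 42)
  have hK400 : (400:ℝ) ≤ K := by linarith
  obtain ⟨hδ0, hon, hδle⟩ := family_params_damped hK hML
  have hK0 : 0 < K := by linarith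
  have hK1 : 1 ≤ K := by linarith
  have hη0 : 0 ≤ η := (hE 0 ⟨le_rfl, zero_le_two⟩ 0).1.trans (hE 0 ⟨le_rfl, zero_le_two⟩ 0).2
  have hη100 : η ≤ 1 / 100 := hη.trans (by norm_num)
  have hML1250 : 1250 * Real.log K ≤ M := by linarith
  obtain ⟨hε1, -, hε100, hεexp⟩ := eps_facts hK16 hM0 hMK hε hεle
  -- `ε² ≤ K⁻²⁰⁰ ≤ 1/(12K²⁰)`
  have hεK : ε ^ 2 ≤ 1 / (12 * K ^ 20) := by
    have h1 : ε ^ 2 ≤ (1 / K ^ 100) ^ 2 := pow_le_pow_left₀ hε.le hε100 2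
    have h2 : (1 / K ^ 100) ^ 2 = 1 / (K ^ 180 * K ^ 20) := by rw [div_pow, one_pow, ← pow_mul, ← pow_add]
    have h3 : 1 / (K ^ 180 * K ^ 20) ≤ 1 / (12 * K ^ 20) := by
      apply one_div_le_one_div_of_le (by positivity)
      have h180 : (12:ℝ) ≤ K ^ 180 := le_trans (by linarith) (le_self_pow₀ hK1 (by norm_num))
      exact mul_le_mul_of_nonneg_right h180 (by positivity)
    linarith [h2 ▸ h1]
  have hh5 : -(1 / 5) ≤ X 0 1 / ε := by rw [le_div_iff₀ hε]; linarith [h0.2.2.1]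
  obtain ⟨τ, ⟨hlo, hhi, hτ1, hτ33⟩, hcτeq, hwin⟩ :=
    quietPhase hX hE h0 hε hε1 hM0 hMK hK16 hML1250 hεK hη
  have hcτ : ∀ t, 0 ≤ t → t ≤ τ → X t 2 ≤ ε ^ 2 / K ^ 10 :=
    fun t h0t htτ => (hwin t ⟨h0t, htτ⟩).1.2
  have hfit : τ + 888 * Real.log K / M + (sqrt K)⁻¹ ≤ 2 := window_fits hK400 hτ33 hδle
  have hτ2 : τ ≤ 2 := by
    have : 0 < (sqrt K)⁻¹ := (invSqrt_facts hK16).1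
    linarith
  refine ⟨τ, ?_, ?_, ?_⟩
  · have hlog0 : 0 ≤ Real.log K := by linarith
    have hq0 : 0 ≤ (max (-(X 0 1 / ε)) 0) ^ 2 := sq_nonneg _
    have hx : 0 ≤ 24 * Real.log K / M + 30 * η + (max (-(X 0 1 / ε)) 0) ^ 2 := by positivity
    have hyx : 10 / M + 30 * η ≤ 24 * Real.log K / M + 30 * η + (max (-(X 0 1 / ε)) 0) ^ 2 := by
      have : 10 / M ≤ 24 * Real.log K / M := div_le_div_of_nonneg_right (by linarith) hM0.le
      linarith
    exact abs_add_sub_sqrt_le hτ1 hh5 hx hyx (by linarith) (by linarith)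
  · intro t ht
    exact able_window hX hE h0 hε hε1 hM0.le hK16 hεK hε100 hτ2 hcτ ht
  · intro t ht
    have ht0 : t ∈ Icc (0:ℝ) 2 := by
      refine ⟨?_, ht.2⟩
      have : 0 < (sqrt K)⁻¹ := (invSqrt_facts hK16).1
      have h1 := ht.1
      rw [one_div] at h1
      linarith
    exact beable_of_sum_sq hX hE h0 hK16 ht0
      (late_sum_sq hX hE h0 hε hε1 hM0 hMK hK16 hεK hε100 hεexp hη100 hδ0 hon hN4 hτ1 hfit
        hcτ hcτeq ht)

open HeadStart in
/-- The signed head-start gate theorem for the EXPLICIT datum `(√(1 - b₀²), b₀, 0, 0, 0)`,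
`-ε/5 ≤ b₀ ≤ 2ε/5` (`h = b₀/ε`): critical time `|t_c + b₀/ε - √(2 + (b₀/ε)²)| ≤ 24 log K/M + 30η + h₋²`,
then (able) and (beable) exactly as in `HeadStart.firingPhase`. [cite: Tao2016AveragedNS, Theorem 5.3, §5.5] -/
theorem HeadStart.firingPhase_explicit {K M ε η b₀ : ℝ} {E X : ℝ → Fin 5 → ℝ}
    (hX : ∀ t ∈ Icc (0:ℝ) 2, HasDerivAt X (delayCircuitWith K M ε (X t) - E t * X t) t)
    (hE : ∀ t ∈ Icc (0:ℝ) 2, ∀ i, 0 ≤ E t i ∧ E t i ≤ η)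
    (hb0 : -(1 / 5 * ε) ≤ b₀) (hb : b₀ ≤ 2 / 5 * ε) (h0 : X 0 = ![sqrt (1 - b₀ ^ 2), b₀, 0, 0, 0])
    (hK : 2 * 20 ^ 42 * (Nat.factorial 42 : ℝ) + 16 ≤ K) (hML : 3000 * Real.log K ≤ M)
    (hMK : M ≤ K ^ 10) (hε : 0 < ε) (hεle : ε ≤ exp (-(10 * M)) / K ^ 100) (hη : η ≤ 1 / 1000) :
    ∃ tc : ℝ, |tc + b₀ / ε - Real.sqrt (2 + (b₀ / ε) ^ 2)| ≤ 24 * Real.log K / M + 30 * η + (max (-(b₀ / ε)) 0) ^ 2 ∧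
      (∀ t ∈ Icc 0 tc,
        |X t 0 - 1| ≤ 200 / K ^ 10 + 2 * η ∧ ∀ i : Fin 5, i ≠ 0 → |X t i| ≤ 200 / K ^ 10) ∧
      (∀ t ∈ Icc (tc + 888 * Real.log K / M + 1 / Real.sqrt K) 2,
        |X t 4 - 1| ≤ 200 / K ^ 10 + 4 * η ∧ ∀ i : Fin 5, i ≠ 4 → |X t i| ≤ 200 / K ^ 10) := by
  obtain ⟨hK16, hM0, -⟩ := family_params hK hML
  have hε1 : ε ≤ 1 := (eps_facts hK16 hM0 hMK hε hεle).1
  have hb1 : X 0 1 = b₀ := by rw [h0]; rfl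
  have h := HeadStart.firingPhase hX hE (hs_of_explicit hε1 hb0 hb h0) hK hML hMK hε hεle hη
  rwa [hb1] at h

end Summit.NavierStokesRegularity.FluidComputer
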